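import Summits.ResolutionOfSingularities.ResolutionOfSingularities.Theorems.HomologicalConductorNoZenoRMinimalOfQuadraticTransform
import Summits.ResolutionOfSingularities.ResolutionOfSingularities.Theorems.HomologicalConductorNoZenoRNormalStagesOfQuadraticNormal
import Summits.ResolutionOfSingularities.ResolutionOfSingularities.Theorems.HomologicalConductorNoZenoRResolutionIsBlowup
import Summits.ResolutionOfSingularities.ResolutionOfSingularities.Theorems.HomologicalConductorNoZenoExcCurvesLocalization
import Literature.AlgebraicGeometry.Resolution.NormalSurfaceSingularLocus
import Literature.AlgebraicGeometry.Resolution.ExceptionalCurvesLocalizedResolution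
import Literature.AlgebraicGeometry.Resolution.AffineBlowupUnique
import Literature.AlgebraicGeometry.Resolution.BlowupDimension
import HarnessLib

/-!
# Crux `NoZenoR` (stmt-ResolutionOfSingularities-19943) — the quadratic transform of a rational surface singularity has
# FINITELY MANY non-regular points, each the image of an integral exceptional curve of any desingularization dominating it

Route `ResolutionOfSingularities/HomologicalConductor` (cell decomp-res, hand leafhand-res-homologicalconduct-24 g0).
OURS: AI-written proof over tree theorems, weaker than expert review; nothing here is a statement of the manuscript
under review (Hironaka 2017).  SUPPORT level, counted 0.  Def-free, fact-free (Lipman (8.1) is the tree theorem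
`QuadraticTransform.Lipman1969_8_1_holds`).

`S` rational non-regular, `π : X → Spec S` a desingularization, `V = Bl_𝔪 Spec S`, `σ : X → V` a desingularization of `V`
with `σ ≫ (V → Spec S) = π` (Lipman (*), p. 203):

* `base_eq_closedPoint_of_not_isRegularLocalRing_stalk` — a non-regular point of `V` lies over the closed point of `S`
  (off `V(𝔪)` the blow-up is an isomorphism onto the regular punctured spectrum of the normal `S`);
* `exists_mem_excCurvePoints_apply_eq_of_not_isRegularLocalRing` — a non-regular point `v` of `V` is the image `σ η` of
  some `η ∈ excCurvePoints π`: the base change `X ×_V Spec 𝒪_{V,v} → Spec 𝒪_{V,v}` is a desingularization of a NON-regular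
  two-dimensional normal local ring (Lipman (8.1), Prop. (1.2)), so it has an integral exceptional curve
  (`IsResolution.excCurvePoints_nonempty`), whose image in `X` has height one (`ExcCount.height_apply_eq_of_isEmbedding`);
* **`finite_setOf_not_isRegularLocalRing_stalk`** — hence the non-regular points of `V` form a FINITE set.

This is the input `Z` (finite, closed, off the generic point) of `GlobalResolution.IsMinimalResolution.pullback_snd_fromSpecStalk`
([U] of memo MEMO-19943-hand24g0-M0-ROAD.md) for `Y = Bl_𝔪 Spec S`.  No crux or summit statement is proved here.
-/

noncomputable section

-- single-problem summit: the doubled namespace component `ResolutionOfSingularities` is forced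
set_option linter.dupNamespace false

open CategoryTheory CategoryTheory.Limits AlgebraicGeometry TopologicalSpace IsLocalRing
open Literature.AlgebraicGeometry Literature.AlgebraicGeometry.Resolution

namespace Summit.ResolutionOfSingularities.ResolutionOfSingularities.Theorems.NoZeno.FirstKind

variable {S : Type} [CommRing S] [IsNoetherianRing S] [IsLocalRing S] [IsDomain S] [IsIntegrallyClosed S]

omit [IsNoetherianRing S] [IsIntegrallyClosed S] in
/-- The ideal sheaf of `𝔪` on `Spec S` is non-zero for `dim S = 2`. [folklore] -/
theorem affineBlowupIdealSheaf_maximalIdeal_ne_bot (hdim : ringKrullDim S = 2) :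
    affineBlowup.idealSheaf (maximalIdeal S) ≠ ⊥ := by
  intro h
  have hsupp := affineBlowup.support_idealSheaf (maximalIdeal S)
  rw [h, Scheme.IdealSheafData.support_bot] at hsupp
  have hgen : (⊥ : PrimeSpectrum S) ∈ PrimeSpectrum.zeroLocus ((maximalIdeal S : Ideal S) : Set S) := by
    rw [← hsupp]; trivial
  rw [PrimeSpectrum.mem_zeroLocus] at hgen
  have hm : maximalIdeal S = ⊥ := le_bot_iff.mp hgen
  exact QuadraticTransform.maximalIdeal_ne_bot_of_ringKrullDim_eq_two hdim hm

/-- **A non-regular point of `Bl_𝔪 Spec S` lies over the closed point** (`S` a two-dimensional normal local domain):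
off `V(𝔪)` the blowing up is an isomorphism, and the punctured spectrum of `S` is regular (normal of dimension `≤ 1`).
[cite: Lipman1969, Theorem (4.1), proof (p. 204)] -/
theorem base_eq_closedPoint_of_not_isRegularLocalRing_stalk (hdim : ringKrullDim S = 2)
    {v : affineBlowup (maximalIdeal S)}
    (hv : ¬ IsRegularLocalRing ((affineBlowup (maximalIdeal S)).presheaf.stalk v)) :
    (affineBlowup.π (maximalIdeal S)).base v = closedPoint S := by
  by_contra hne
  haveI := affineBlowup.isIso_morphismRestrict_compl_support (maximalIdeal S)
  have hvU : (affineBlowup.π (maximalIdeal S)).base v ∈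
      (⟨((affineBlowup.idealSheaf (maximalIdeal S)).support : Set (Spec (.of S)))ᶜ,
        (affineBlowup.idealSheaf (maximalIdeal S)).support.isClosed.isOpen_compl⟩ : (Spec (.of S)).Opens) := by
    change (affineBlowup.π (maximalIdeal S)).base v ∉ ((affineBlowup.idealSheaf (maximalIdeal S)).support : Set _)
    rw [affineBlowup.support_idealSheaf]
    intro hmem
    have hle : ((maximalIdeal S : Ideal S) : Set S) ⊆ (((affineBlowup.π (maximalIdeal S)).base v).asIdeal : Set S) :=
      hmem
    apply hne
    exact PrimeSpectrum.ext ((IsLocalRing.maximalIdeal.isMaximal S).eq_of_le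
      ((affineBlowup.π (maximalIdeal S)).base v).2.ne_top hle).symm
  apply hv
  have hreg := (mem_regularLocus_iff_of_isIso_morphismRestrict (affineBlowup.π (maximalIdeal S)) _ v hvU).mpr
    (mem_regularLocus_of_ringKrullDim_stalk_le_one QuadraticTransform.isIntegrallyClosed_stalk_Spec
      (ResolutionIsBlowup.ringKrullDim_stalk_Spec_le_one_of_ne_closedPoint hdim.le _ hne))
  exact hreg

section WithResolution

variable {X : Scheme.{0}} (π : X ⟶ Spec (.of S))

/-- **Every non-regular point of the quadratic transform is the image of an integral exceptional curve.**  `S` rational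
non-regular, `π : X → Spec S` a desingularization, `σ : X → Bl_𝔪 Spec S` a desingularization with `σ ≫ (Bl_𝔪 → Spec S) = π`,
`v` a non-regular point of `Bl_𝔪 Spec S`: some `η ∈ excCurvePoints π` has `σ η = v`.
[cite: Lipman1969, Theorem (4.1), proof (p. 204); Proposition (8.1) (p. 212)] -/
theorem exists_mem_excCurvePoints_apply_eq_of_not_isRegularLocalRing (hdim : ringKrullDim S = 2)
    (hrat : HasRationalSingularity S) (hπ : IsResolution π) (σ : X ⟶ affineBlowup (maximalIdeal S))
    (hσ : σ ≫ affineBlowup.π (maximalIdeal S) = π) (hσres : IsResolution σ)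
    {v : affineBlowup (maximalIdeal S)}
    (hv : ¬ IsRegularLocalRing ((affineBlowup (maximalIdeal S)).presheaf.stalk v)) :
    ∃ η ∈ excCurvePoints π, σ.base η = v := by
  have hb : IsBlowup (affineBlowup.π (maximalIdeal S)) (affineBlowup.idealSheaf (maximalIdeal S)) :=
    affineBlowup.isBlowup _
  have hI0 := affineBlowupIdealSheaf_maximalIdeal_ne_bot (S := S) hdim
  haveI : IsIntegral (affineBlowup (maximalIdeal S)) := hb.isIntegral hI0
  haveI : IsLocallyNoetherian (affineBlowup (maximalIdeal S)) :=
    LocallyOfFiniteType.isLocallyNoetherian (affineBlowup.π (maximalIdeal S))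
  haveI : CompactSpace (affineBlowup (maximalIdeal S)) :=
    QuasiCompact.compactSpace_of_compactSpace (affineBlowup.π (maximalIdeal S))
  haveI : IsNoetherian (affineBlowup (maximalIdeal S)) := {}
  haveI : IsIntegral X := hπ.isIntegral_source
  haveI : IsProper π := hπ.isProper
  haveI : IsLocallyNoetherian X := LocallyOfFiniteType.isLocallyNoetherian π
  haveI : CompactSpace X := QuasiCompact.compactSpace_of_compactSpace π
  haveI : IsNoetherian X := {}
  have hbir : IsBirational (affineBlowup.π (maximalIdeal S)) := hb.isBirational' hI0
  -- the local ring at `v`: normal (8.1), non-regular, hence of dimension `2`; `v` is a closed point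
  haveI hvn : IsIntegrallyClosed ((affineBlowup (maximalIdeal S)).presheaf.stalk v) :=
    QuadraticTransform.Lipman1969_8_1_holds S hdim hrat v
  have hdim₁ : ringKrullDim ((affineBlowup (maximalIdeal S)).presheaf.stalk v) = 2 :=
    QuadraticTransform.ringKrullDim_stalk_eq_two_of_not_isRegularLocalRing hdim (affineBlowup.π (maximalIdeal S))
      hbir hvn hv
  have hvc : IsClosed ({v} : Set (affineBlowup (maximalIdeal S))) := by
    refine isClosed_singleton_of_not_mem_regularLocus
      (fun w => QuadraticTransform.Lipman1969_8_1_holds S hdim hrat w) ?_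
      (fun h => hv ((Scheme.mem_regularLocus v).mp h))
    have h2 : topologicalKrullDim (PrimeSpectrum S) ≤ (2 : ℕ) := by
      rw [PrimeSpectrum.topologicalKrullDim_eq_ringKrullDim]
      exact_mod_cast hdim.le
    exact hb.topologicalKrullDim_le h2
  -- the germ resolution over `v` has an integral exceptional curve
  have hres₁ : IsResolution (pullback.snd σ ((affineBlowup (maximalIdeal S)).fromSpecStalk v)) :=
    hσres.pullback_snd_fromSpecStalk v
  obtain ⟨ζ, hζ⟩ := hres₁.excCurvePoints_nonempty hdim₁ hv
  have hσζ : σ.base ((pullback.fst σ ((affineBlowup (maximalIdeal S)).fromSpecStalk v)).base ζ) = v := by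
    rw [← Scheme.Hom.comp_apply, pullback.condition, Scheme.Hom.comp_apply, hζ.1]
    exact Scheme.fromSpecStalk_closedPoint
  refine ⟨(pullback.fst σ ((affineBlowup (maximalIdeal S)).fromSpecStalk v)).base ζ, ⟨?_, ?_⟩, hσζ⟩
  · -- over the closed point of `S`
    rw [← hσ, Scheme.Hom.comp_apply, hσζ]
    exact base_eq_closedPoint_of_not_isRegularLocalRing_stalk hdim hv
  · -- height one: `pullback.fst` is an embedding whose range contains every specialisation of the point
    rw [ExcCount.height_apply_eq_of_isEmbedding (pullback.fst σ ((affineBlowup (maximalIdeal S)).fromSpecStalk v))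
      (pullback.fst σ ((affineBlowup (maximalIdeal S)).fromSpecStalk v)).isEmbedding ζ ?_]
    · exact hζ.2
    · intro x hx
      rw [Scheme.Pullback.range_fst, Set.mem_preimage, Scheme.range_fromSpecStalk]
      have h1 : v ⤳ σ.base x := hσζ ▸ hx.map σ.base.hom.continuous
      have h2 : σ.base x ∈ closure ({v} : Set (affineBlowup (maximalIdeal S))) :=
        specializes_iff_mem_closure.mp h1
      rw [hvc.closure_eq] at h2
      rw [Set.mem_setOf_eq, Set.mem_singleton_iff.mp h2]

/-- **The quadratic transform of a rational surface singularity has finitely many non-regular points** (each is the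
image of one of the finitely many integral exceptional curves of a desingularization dominating it).
[cite: Lipman1969, Theorem (4.1), proof (p. 204)] -/
theorem finite_setOf_not_isRegularLocalRing_stalk (hdim : ringKrullDim S = 2) (hrat : HasRationalSingularity S)
    (hπ : IsResolution π) (σ : X ⟶ affineBlowup (maximalIdeal S))
    (hσ : σ ≫ affineBlowup.π (maximalIdeal S) = π) (hσres : IsResolution σ) :
    {v : affineBlowup (maximalIdeal S) |
      ¬ IsRegularLocalRing ((affineBlowup (maximalIdeal S)).presheaf.stalk v)}.Finite := by
  refine ((IsResolution.excCurvePoints_finite hdim hπ).image σ.base).subset fun v hv => ?_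
  obtain ⟨η, hη, hηv⟩ := exists_mem_excCurvePoints_apply_eq_of_not_isRegularLocalRing π hdim hrat hπ σ hσ hσres hv
  exact ⟨η, hη, hηv⟩

end WithResolution

end Summit.ResolutionOfSingularities.ResolutionOfSingularities.Theorems.NoZeno.FirstKind

end
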